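import Mathlib
import Summits.ValiantsHypothesis.ValiantsHypothesis.Theorems.GrenetZeonTwoDimCoefficientsDefs
import Summits.ValiantsHypothesis.ValiantsHypothesis.Theorems.GrenetZeonTwoDimCoefficientsSquareInstance
import Summits.ValiantsHypothesis.ValiantsHypothesis.Theorems.GrenetZeonTwoDimCoefficientsStubUnitDichotomy

/-!
# Crux `GrenetZeon.TwoDimCoefficients` (stmt-ValiantsHypothesis-8062): the square of the shifted
# permanent has determinantal complexity `≥ n²/2 − 1`, unconditionally

`UNIT-CASE-NOTE.md` (val-width-8062-p2) observed that the registered `UnitDichotomy` implies a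
quadratic lower bound for the determinantal complexity of the SQUARES `c·(per_n + K)²` — powerful
polynomials on which the Hessian-of-the-determinant method is void — and recorded the implication as
`unitDichotomy_sq_shift_bound`.  Since `UnitDichotomy` is now a theorem
(`stub_unitDichotomy`, kernel-plane proof, `GrenetZeonTwoDimCoefficientsStubUnitDichotomy`), the bound
holds outright: an affine `m × m` matrix with `det A = c·(per_n + K)²` (`c, K ≠ 0`, `n ≥ 3`) has
`n² ≤ 2m + 2`.  (The sharp form `n² ≤ 2m` follows from `sq_le_two_mul_of_det_eq_C_add_perPoly_mul`.)

HONEST FRAMING: a corollary in the Mignon–Ressayre regime; `VP ≠ VNP` is not moved.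
-/

set_option linter.dupNamespace false

noncomputable section

namespace Summit.ValiantsHypothesis.ValiantsHypothesis.Cruxes.TwoDimCoefficients.DimTwoCases

open MvPolynomial Matrix
open Literature.Computability.AlgebraicComplexity

/-- **`dc(c·(per_n + K)²) ≥ n²/2 − 1`, unconditionally** (`c, K ≠ 0`, `n ≥ 3`): the powerful unit
of `UNIT-CASE-NOTE.md` is no obstruction. [cite: MignonRessayre2004, Thm. 1.1] -/
theorem sq_shift_bound {n : ℕ} (hn : 3 ≤ n) {m : ℕ} {c K : ℂ} (hc : c ≠ 0) (hK : K ≠ 0)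
    (A : AffMat n m) (hA : IsAffine A) (hdA : A.det = C c * (perPoly (Fin n) ℂ + C K) ^ 2) :
    n ^ 2 ≤ 2 * m + 2 :=
  unitDichotomy_sq_shift_bound stub_unitDichotomy hn hc hK A hA hdA

end Summit.ValiantsHypothesis.ValiantsHypothesis.Cruxes.TwoDimCoefficients.DimTwoCases

end
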